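import Summits.AtomisticToContinuum.Crystallization.Theses.IsometryAtoms

/-!
# Birth certificate (BC3) — crux `IsometryAtoms.MinimisingLawsHaveAtoms` (stmt-AtomisticToContinuum-15776)

Skeleton registrar `planner-skel-stmt-AtomisticToContinuum-15776-0` (2026-08-17), route
`route-AtomisticToContinuum-IsometryAtoms` (rank-2 crux PURITY; re-audit bin REPAIRABLE,
`bc3_audit: null`). Published as `Cruxes/MinimisingLawsHaveAtoms/Lines/birth.lean`; no other line is
registered on this crux at the time of writing (`ledger crux ls`: no workfiles, no `Disproof.lean`).

THE CRUX (verbatim the route decl). For every hard core `δ > 0` and every probability law `P` on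
rooted configurations `μ : Measure ℝ³` that is a.s. `IsRootedHardCore δ`, `IsPointStationaryLaw`
(Mecke / mass transport) and MINIMISING (`E_P[rootEnergy V_LJ] ≤ e* := ⨅_Q e(Q)` over periodic `Q`),
there is ONE set `Y ⊂ ℝ³` whose ROOTED ISOMETRY CLASS
`cl(Y) := {count|((A(· − q)) '' Y) : A a linear isometry, q ∈ Y}` has positive `P`-mass — the law
has an atom modulo `E(3)`.

THE LINE ("purity = support on perfect crystals + optimality of what is charged + isolation of the
optimum"; the Cantor–Bendixson reading of the route thesis: a law carried by COUNTABLY many classes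
has an atom). Three registered stubs and the route's own rank-3 crux `MinimisingLawsCohesive`
(item stmt-AtomisticToContinuum-15777, taken BY NAME as an admissible registered obligation — any
"perfect crystal" line for PURITY needs cohesion: a minimising law charging films or sponges is not
carried by full-rank periodic sets, and `closes` consumes both cruxes for every law of the frame
anyway, so nothing is lost relative to the route):

* `stub_cohesiveLawsCarriedByCrystals` — THE CONTENT (Palm crystallization, SUPPORT form,
  structure unnamed; open-problem strength, strictly below the a.s.-hcp target `PalmRigidity`
  stmt-9224 of route PalmUnimodularRigidity, which implies it): a minimising point-stationary
  hard-core law that is a.s. relatively dense is carried by EXACT rooted isometric copies of point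
  sets of periodic configurations: `P`-a.s. `μ ∈ cl(Q.points)` for some `Q : PeriodicConfiguration 3`
  (depending on `μ`). Zero-density defects are invisible to a point-stationary law (the root is a
  typical point), positive-density defects cost energy; what can fail is a diffuse family of
  aperiodic minimisers (quasicrystal / unlocked Hägg stacking word) — the declared kill criterion of
  the crux itself.
* `stub_carriedCrystalsMinimise` — SITE AVERAGING (Mecke; size L, believed provable): if a law of
  the frame is a.s. carried by rooted perfect crystals, then a.s. the carried crystal is OPTIMAL,
  `e(Q) = e*`. Mass transport inside the atom-free statement: the Mecke identity with
  `g(μ, y) = rootEnergy(μ)·1{‖y‖ ≤ r}/N_r(μ)` and `r → ∞` gives `E_P[rootEnergy] = E_P[e(Q_μ)]`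
  (a point-stationary rooting of a perfect crystal sees the sites of a cell uniformly), while
  `e(Q_μ) ≥ e*` pointwise (`⨅`, range bounded below — stability, cf. item CrysPeriodicBddBelow) and
  `E_P[rootEnergy] ≤ e*`; `rootEnergy` is a.s. bounded by `C(δ)` (δ-separation), so no Bochner junk.
* `stub_minimisingCrystalsCountable` — RIGIDITY / ISOLATION (no continuous degeneracy of the
  periodic optimum; open but believed with room to spare: for `V_LJ` the periodic minimiser is
  expected to be unique up to isometry, hcp at its optimal dilation; periodic Barlow stackings are
  countably many in any case, so only an elastic / phason zero mode — the Sütő barrier, whose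
  hypothesis class excludes `V_LJ` — can break it): the point sets of OPTIMAL periodic configurations
  (`e(Q) = e*`) are, modulo isometries `s ↦ B s + t`, at most countably many.

COMPOSITION (`MinimisingLawsHaveAtoms_of`, sorry-free, concludes the route decl BY NAME): for a law
of the frame, cohesion (15777) + stub 1 give a.s. `μ ∈ cl(Q_μ.points)`; stub 2 upgrades to
`e(Q_μ) = e*`; stub 3 writes `Q_μ.points = B '' Y_n + t`, and `cl(B '' Y + t) ⊆ cl(Y)` (compose the
linear isometries, `image_rooted_comp`), so a.s. `μ ∈ ⋃ₙ cl(Y_n)`; a probability (outer) measure whose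
a.e. point lies in a countable union charges one member (`exists_pos_measure_of_ae_mem_iUnion`:
`1 = P univ ≤ P(⋃) + P(⋃ᶜ)`, σ-subadditivity) — that member `cl(Y_n)` is the atom.

CALIBRATION. No stub gives the crux or the summit on its own. BC3 probes (registrar session, files
`bc/<stub>_to_{crux,summit}.lean`, `lean check` on the farm): for each of the 3 stubs `S` and each
target `T ∈ {MinimisingLawsHaveAtoms, Crystallization}` the BC2 battery was run as NINE singleton
examples `example : S → T := by <tac>` with `<tac>` ∈ {`exact?`, `simpa`, `simpa [S]`,
`unfold S; simpa`, `aesop`, `intro h; exact?`, `unfold S T; aesop`, `unfold S T; simpa`,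
`unfold S T; intro h; exact?`} under `maxHeartbeats 400000`: 54/54 FAIL (rc 1 in all six files;
`exact?`: "could not close the goal" — against the folded summit `exact?` times out at `whnf`, against
the unfolded summit it fails cleanly; `simpa`: "assumption failed"; `aesop`: "failed to prove the goal
after exhaustive search" / unsolved goals). The converse probes `MinimisingLawsHaveAtoms → S` fail
3/3 as well (`bc/converse_crux_to_stubs.lean`). Informally: stub 1 has no atom (a diffuse law over a
continuum of perfect crystals satisfies it), stub 2 is conditional site-averaging with no support
statement, stub 3 speaks of no law at all; conversely an atom says nothing about the rest of the
mass (stub 1) nor about periodic minimisers (stub 3).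

DISPROOF USED: none on file for this crux (`ledger crux ls stmt-AtomisticToContinuum-15776`: no
`Disproof.lean`, no `Negative/`); `ledger negatives --problem AtomisticToContinuum` (20 entries,
2026-08-17) has no law-level / rooted-class / periodic-minimiser statement. Nothing here is an
instance of a refuted statement.
-/

noncomputable section

namespace Summit.AtomisticToContinuum.Crystallization.Cruxes.MinimisingLawsHaveAtoms.Birth

open MeasureTheory
open Literature.MathematicalPhysics.StatisticalMechanics Literature.Probability.Process
open Summit.AtomisticToContinuum.Crystallization.Theses.IsometryAtoms (MinimisingLawsHaveAtoms MinimisingLawsCohesive)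

/-! ## §1 Vocabulary (readability only; the registered stubs of §2 are stated verbatim over tree
declarations, fully qualified, so that their recorded signatures elaborate in the route context) -/

/-- The rooted isometry class of a set `Y ⊂ ℝ³` as an event on rooted configurations — verbatim
the event of the crux: `μ = count|((A(· − q)) '' Y)` for a linear isometry `A` and a base point
`q ∈ Y`. -/
def rootedClass (Y : Set (EuclideanSpace ℝ (Fin 3))) :
    Set (Measure (EuclideanSpace ℝ (Fin 3))) :=
  {μ | ∃ A : EuclideanSpace ℝ (Fin 3) →ₗᵢ[ℝ] EuclideanSpace ℝ (Fin 3), ∃ q ∈ Y,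
    μ = (Measure.count : Measure (EuclideanSpace ℝ (Fin 3))).restrict ((fun s => A (s - q)) '' Y)}

/-- `e* = ⨅_Q e(Q)`, the periodic ground-state energy per particle of `V_LJ` in `ℝ³`. -/
def eStar : ℝ :=
  ⨅ Q : PeriodicConfiguration 3, Q.energyPerParticle lennardJones

/-! ## §2 The registered stubs (`sorry` lives only in these three theorems) -/

/-- **STUB 1 — cohesive minimising laws are carried by perfect crystals** (Palm crystallization,
support form; THE CONTENT, open-problem strength). Frame of the crux + the conclusion of
`MinimisingLawsCohesive` for this `P` ⇒ `P`-a.s. `μ` is an exact rooted isometric copy of the point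
set of some periodic configuration. -/
theorem stub_cohesiveLawsCarriedByCrystals :
    ∀ δ : ℝ, 0 < δ → ∀ P : MeasureTheory.Measure (MeasureTheory.Measure (EuclideanSpace ℝ (Fin 3))), MeasureTheory.IsProbabilityMeasure P → (∀ᵐ μ ∂P, Literature.Probability.Process.IsRootedHardCore δ μ) → Literature.Probability.Process.IsPointStationaryLaw P → (∫ μ, Literature.MathematicalPhysics.StatisticalMechanics.rootEnergy Literature.MathematicalPhysics.StatisticalMechanics.lennardJones μ ∂P) ≤ (⨅ Q : Literature.MathematicalPhysics.StatisticalMechanics.PeriodicConfiguration 3, Q.energyPerParticle Literature.MathematicalPhysics.StatisticalMechanics.lennardJones) → (∀ᵐ μ ∂P, ∃ R₀ : ℝ, ∀ z : EuclideanSpace ℝ (Fin 3), ∃ y : EuclideanSpace ℝ (Fin 3), μ {y} ≠ 0 ∧ dist z y ≤ R₀) → ∀ᵐ μ ∂P, ∃ Q : Literature.MathematicalPhysics.StatisticalMechanics.PeriodicConfiguration 3, ∃ A : EuclideanSpace ℝ (Fin 3) →ₗᵢ[ℝ] EuclideanSpace ℝ (Fin 3), ∃ q ∈ Q.points, μ =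 (MeasureTheory.Measure.count : MeasureTheory.Measure (EuclideanSpace ℝ (Fin 3))).restrict ((fun s => A (s - q)) '' Q.points) := by
  sorry

/-- **STUB 2 — carried crystals are optimal** (site averaging by the Mecke identity; size L,
believed provable). Frame of the crux + "`P`-a.s. `μ` is a rooted perfect crystal" ⇒ `P`-a.s. the
carried periodic configuration attains `e* = ⨅_Q e(Q)`. -/
theorem stub_carriedCrystalsMinimise :
    ∀ δ : ℝ, 0 < δ → ∀ P : MeasureTheory.Measure (MeasureTheory.Measure (EuclideanSpace ℝ (Fin 3))), MeasureTheory.IsProbabilityMeasure P → (∀ᵐ μ ∂P, Literature.Probability.Process.IsRootedHardCore δ μ) → Literature.Probability.Process.IsPointStationaryLaw P → (∫ μ, Literature.MathematicalPhysics.StatisticalMechanics.rootEnergy Literature.MathematicalPhysics.StatisticalMechanics.lennardJones μ ∂P) ≤ (⨅ Q : Literature.MathematicalPhysics.StatisticalMechanics.PeriodicConfiguration 3, Q.energyPerParticle Literature.MathematicalPhysics.StatisticalMechanics.lennardJones) → (∀ᵐ μ ∂P, ∃ Q : Literature.MathematicalPhysics.StatisticalMechanics.PeriodicConfiguration 3,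 ∃ A : EuclideanSpace ℝ (Fin 3) →ₗᵢ[ℝ] EuclideanSpace ℝ (Fin 3), ∃ q ∈ Q.points, μ = (MeasureTheory.Measure.count : MeasureTheory.Measure (EuclideanSpace ℝ (Fin 3))).restrict ((fun s => A (s - q)) '' Q.points)) → ∀ᵐ μ ∂P, ∃ Q : Literature.MathematicalPhysics.StatisticalMechanics.PeriodicConfiguration 3, Q.energyPerParticle Literature.MathematicalPhysics.StatisticalMechanics.lennardJones = (⨅ Q' : Literature.MathematicalPhysics.StatisticalMechanics.PeriodicConfiguration 3, Q'.energyPerParticle Literature.MathematicalPhysics.StatisticalMechanics.lennardJones) ∧ ∃ A : EuclideanSpace ℝ (Fin 3) →ₗᵢ[ℝ] EuclideanSpace ℝ (Fin 3), ∃ q ∈ Q.points, μ = (MeasureTheory.Measure.count : MeasureTheory.Measure (EuclideanSpace ℝ (Fin 3))).restrict ((fun s => A (s - q)) '' Q.points) := by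
  sorry

/-- **STUB 3 — optimal periodic configurations are countable modulo isometry** (rigidity /
isolation of the periodic optimum; open, believed: for `V_LJ` one class, hcp at its optimal
dilation). There is a sequence of sets `Y n ⊂ ℝ³` such that the point set of every periodic
configuration with `e(Q) = e*` is `B '' (Y n) + t` for some `n`, some linear isometry `B` and some
translation `t`. (Vacuous if the periodic infimum is not attained; a continuum of sheared / phason-
shifted optima — Sütő-type degeneracy — is exactly what would make it false.) -/
theorem stub_minimisingCrystalsCountable :
    ∃ Y : ℕ → Set (EuclideanSpace ℝ (Fin 3)), ∀ Q : Literature.MathematicalPhysics.StatisticalMechanics.PeriodicConfiguration 3, Q.energyPerParticle Literature.MathematicalPhysics.StatisticalMechanics.lennardJones = (⨅ Q' : Literature.MathematicalPhysics.StatisticalMechanics.PeriodicConfiguration 3, Q'.energyPerParticle Literature.MathematicalPhysics.StatisticalMechanics.lennardJones) → ∃ n : ℕ, ∃ B : EuclideanSpace ℝ (Fin 3) →ₗᵢ[ℝ] EuclideanSpace ℝ (Fin 3), ∃ t : EuclideanSpace ℝ (Fin 3), Q.points = (fun s => B s + t) '' (Y n) := by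
  sorry

/-! ## §3 Name-keyed aliases (hypotheses of the composition)

`Registered.stub_X` is the statement of `stub_X` under the registered stub's short name, so that the
skeleton audit (`#h21_check_skeleton`: hypotheses admissible iff registered obligations / declared
stubs BY NAME) accepts `MinimisingLawsHaveAtoms_of`. -/
namespace Registered

/-- Statement of `stub_cohesiveLawsCarriedByCrystals`, keyed by its registered name. -/
abbrev stub_cohesiveLawsCarriedByCrystals : Prop :=
  ∀ δ : ℝ, 0 < δ → ∀ P : Measure (Measure (EuclideanSpace ℝ (Fin 3))), IsProbabilityMeasure P →
    (∀ᵐ μ ∂P, IsRootedHardCore δ μ) → IsPointStationaryLaw P →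
    (∫ μ, rootEnergy lennardJones μ ∂P) ≤ eStar →
    (∀ᵐ μ ∂P, ∃ R₀ : ℝ, ∀ z : EuclideanSpace ℝ (Fin 3), ∃ y : EuclideanSpace ℝ (Fin 3),
      μ {y} ≠ 0 ∧ dist z y ≤ R₀) →
    ∀ᵐ μ ∂P, ∃ Q : PeriodicConfiguration 3, μ ∈ rootedClass Q.points

/-- Statement of `stub_carriedCrystalsMinimise`, keyed by its registered name. -/
abbrev stub_carriedCrystalsMinimise : Prop :=
  ∀ δ : ℝ, 0 < δ → ∀ P : Measure (Measure (EuclideanSpace ℝ (Fin 3))), IsProbabilityMeasure P →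
    (∀ᵐ μ ∂P, IsRootedHardCore δ μ) → IsPointStationaryLaw P →
    (∫ μ, rootEnergy lennardJones μ ∂P) ≤ eStar →
    (∀ᵐ μ ∂P, ∃ Q : PeriodicConfiguration 3, μ ∈ rootedClass Q.points) →
    ∀ᵐ μ ∂P, ∃ Q : PeriodicConfiguration 3,
      Q.energyPerParticle lennardJones = eStar ∧ μ ∈ rootedClass Q.points

/-- Statement of `stub_minimisingCrystalsCountable`, keyed by its registered name. -/
abbrev stub_minimisingCrystalsCountable : Prop :=
  ∃ Y : ℕ → Set (EuclideanSpace ℝ (Fin 3)), ∀ Q : PeriodicConfiguration 3,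
    Q.energyPerParticle lennardJones = eStar →
    ∃ n : ℕ, ∃ B : EuclideanSpace ℝ (Fin 3) →ₗᵢ[ℝ] EuclideanSpace ℝ (Fin 3),
      ∃ t : EuclideanSpace ℝ (Fin 3), Q.points = (fun s => B s + t) '' (Y n)

end Registered

-- the registered stubs inhabit their name-keyed statements (definitional unfolding only)
example : Registered.stub_cohesiveLawsCarriedByCrystals := stub_cohesiveLawsCarriedByCrystals
example : Registered.stub_carriedCrystalsMinimise := stub_carriedCrystalsMinimise
example : Registered.stub_minimisingCrystalsCountable := stub_minimisingCrystalsCountable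

/-! ## §4 Proved glue (sorry-free) -/

/-- **Isometric point sets have the same rooted classes**: re-rooting a rooted copy of
`B '' Y + t` at `B q' + t` is the rooted copy of `Y` at `q'` through the composed isometry. -/
theorem image_rooted_comp (A B : EuclideanSpace ℝ (Fin 3) →ₗᵢ[ℝ] EuclideanSpace ℝ (Fin 3))
    (t q' : EuclideanSpace ℝ (Fin 3)) (Y : Set (EuclideanSpace ℝ (Fin 3))) :
    (fun s => A (s - (B q' + t))) '' ((fun s => B s + t) '' Y) =
      (fun s => (A.comp B) (s - q')) '' Y := by
  rw [Set.image_image]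
  refine Set.image_congr' fun s => ?_
  simp only [LinearIsometry.coe_comp, Function.comp_apply, add_sub_add_right_eq_sub,
    LinearIsometry.map_sub]

/-- Hence the rooted class of an isometric image of `Y` is contained in the rooted class of `Y`. -/
theorem rootedClass_image_subset (B : EuclideanSpace ℝ (Fin 3) →ₗᵢ[ℝ] EuclideanSpace ℝ (Fin 3))
    (t : EuclideanSpace ℝ (Fin 3)) (Y : Set (EuclideanSpace ℝ (Fin 3))) :
    rootedClass ((fun s => B s + t) '' Y) ⊆ rootedClass Y := by
  rintro μ ⟨A, q, hq, rfl⟩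
  obtain ⟨q', hq', rfl⟩ := hq
  exact ⟨A.comp B, q', hq', by rw [image_rooted_comp]⟩

/-- **The Cantor–Bendixson seam**: a probability (outer) measure whose almost every point lies in
a countable union of sets charges one of them — no measurability needed
(`1 = P univ ≤ P (⋃ₙ sₙ) + P (⋃ₙ sₙ)ᶜ`, σ-subadditivity). -/
theorem exists_pos_measure_of_ae_mem_iUnion {α : Type*} [MeasurableSpace α] {P : Measure α}
    [IsProbabilityMeasure P] {s : ℕ → Set α} (h : ∀ᵐ x ∂P, x ∈ ⋃ n, s n) :
    ∃ n, 0 < P (s n) := by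
  by_contra hne
  simp only [not_exists, not_lt] at hne
  have h0 : ∀ n, P (s n) = 0 := fun n => nonpos_iff_eq_zero.1 (hne n)
  have hU : P (⋃ n, s n) = 0 := measure_iUnion_null h0
  have hc : P (⋃ n, s n)ᶜ = 0 := mem_ae_iff.1 h
  have h1 : P Set.univ ≤ 0 :=
    calc P Set.univ = P ((⋃ n, s n) ∪ (⋃ n, s n)ᶜ) := by rw [Set.union_compl_self]
      _ ≤ P (⋃ n, s n) + P (⋃ n, s n)ᶜ := measure_union_le _ _
      _ = 0 := by rw [hU, hc, add_zero]
  have h2 : P Set.univ = 0 := nonpos_iff_eq_zero.1 h1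
  rw [measure_univ] at h2
  exact one_ne_zero h2

/-- **`MinimisingLawsHaveAtoms_of`** — the route's rank-3 crux `MinimisingLawsCohesive`
(item stmt-AtomisticToContinuum-15777, by name) and the three registered stubs give the crux
`MinimisingLawsHaveAtoms` BY NAME: a.s. support on rooted perfect crystals (stub 1, fed with
cohesion), a.s. optimality of the carried crystal (stub 2), countably many optimal crystals modulo
isometry (stub 3) and invariance of rooted classes under isometry put almost all of `P` on
`⋃ₙ cl(Yₙ)`; one `cl(Yₙ)` is charged. -/
theorem MinimisingLawsHaveAtoms_of (hcoh : MinimisingLawsCohesive)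
    (h₁ : Registered.stub_cohesiveLawsCarriedByCrystals)
    (h₂ : Registered.stub_carriedCrystalsMinimise)
    (h₃ : Registered.stub_minimisingCrystalsCountable) : MinimisingLawsHaveAtoms := by
  intro δ hδ P hP hhc hst hE
  haveI : IsProbabilityMeasure P := hP
  -- (1) cohesion + stub 1: a.s. a rooted perfect crystal; (2) stub 2: a.s. an optimal one
  have hcry := h₁ δ hδ P hP hhc hst hE (hcoh δ hδ P hP hhc hst hE)
  have hmin := h₂ δ hδ P hP hhc hst hE hcry
  -- (3) stub 3: optimal crystals are isometric images of countably many sets `Y n`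
  obtain ⟨Y, hY⟩ := h₃
  have hcover : ∀ᵐ μ ∂P, μ ∈ ⋃ n, rootedClass (Y n) := by
    filter_upwards [hmin] with μ hμ
    obtain ⟨Q, hQe, hμQ⟩ := hμ
    obtain ⟨n, B, t, hpts⟩ := hY Q hQe
    rw [hpts] at hμQ
    exact Set.mem_iUnion.2 ⟨n, rootedClass_image_subset B t (Y n) hμQ⟩
  -- (4) one of the countably many classes is charged
  obtain ⟨n, hn⟩ := exists_pos_measure_of_ae_mem_iUnion hcover
  exact ⟨Y n, hn⟩

/-- Wiring check: fed with the route item `MinimisingLawsCohesive`, the registered stubs give the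
crux through `MinimisingLawsHaveAtoms_of` exactly as stated. -/
example (hcoh : MinimisingLawsCohesive) : MinimisingLawsHaveAtoms :=
  MinimisingLawsHaveAtoms_of hcoh stub_cohesiveLawsCarriedByCrystals stub_carriedCrystalsMinimise
    stub_minimisingCrystalsCountable

end Summit.AtomisticToContinuum.Crystallization.Cruxes.MinimisingLawsHaveAtoms.Birth

end
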